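import Mathlib.LinearAlgebra.Matrix.Rank
import Literature.InformationTheory.Entropy.LinearMapEntropy
import Literature.Computability.Complexity.PolynomialEntropyApproximation
import HarnessLib

/-!
# Polynomial Entropy Approximation in degree `1`: sparse affine maps over `F₂` and their entropy

The base of the degree dial of route PneNP/SzkEntropy [DGRV, §1 p. 1: "for degree 1 (affine maps)
the entropy is simply determined by the rank, which is computable in polynomial time"].  For a
sparse polynomial map `P : PolyMapF2 n` with the syntactic degree bound `DegLE 1` (every monomial
lists at most one variable index):

* `sum_map_prod_eq_of_degLE_one` — a degree-`≤ 1` sparse polynomial evaluates to the affine form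
  `#{empty monomials} + ∑ⱼ #{occurrences of the monomial [j]} · xⱼ` (multiplicities mod `2`);
* `eval_eq_ofFn_of_degLE_one` — hence `P.eval x` is the list of values of the affine map
  `x ↦ A x + c` with `A i j = #{[j] in Pᵢ} mod 2` (the LINEAR-PART MATRIX, written inline with
  `Matrix.of`) and `c i = #{[] in Pᵢ} mod 2`;
* `entropy_eq_rank_of_degLE_one` — **`H(P(U_n)) = rank_{F₂} A`** (bits), by
  `mapEntropy_univ_affine_zmod_two` (fibres of an affine map are kernel cosets) and injectivity of
  `List.ofFn`.

All statements are def-free (the matrix is the explicit `Matrix.of fun i j => ((Pᵢ.count [j] : ℕ) :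
ZMod 2)`), so that a polynomial-time decision procedure for `PEA 1` only has to compute the rank of
this matrix (restricted to the occurring variables) and compare it with the threshold.

## References

* Z. Dvir, D. Gutfreund, G. N. Rothblum, S. Vadhan, *On approximating the entropy of polynomial
  mappings*, ICS 2011 (ECCC TR10-160), §1 p. 1; §3 p. 6 (`PEA`).  bib `DvirGutfreundRothblumVadhan2010`.
-/

namespace Literature.Computability.Complexity

namespace PolyMapF2

open Finset

variable {n : ℕ}

/-- **A degree-`≤ 1` sparse polynomial over `F₂` is an affine form**: if every monomial of `p` lists
at most one variable, then `∑_{μ ∈ p} ∏_{j ∈ μ} xⱼ = #{μ ∈ p : μ = []} + ∑ⱼ #{μ ∈ p : μ = [j]} · xⱼ`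
with multiplicities read mod `2`. [DvirGutfreundRothblumVadhan2010, §1 p. 1]
[cite: DvirGutfreundRothblumVadhan2010, §1 p.1] -/
theorem sum_map_prod_eq_of_degLE_one (p : List (List (Fin n))) (hp : ∀ μ ∈ p, μ.length ≤ 1)
    (x : Fin n → ZMod 2) :
    (p.map fun μ => (μ.map x).prod).sum =
      ((p.count [] : ℕ) : ZMod 2) + ∑ j : Fin n, ((p.count [j] : ℕ) : ZMod 2) * x j := by
  induction p with
  | nil => simp
  | cons μ p ih =>
    have hμ : μ.length ≤ 1 := hp μ (by simp)
    have hp' : ∀ μ' ∈ p, μ'.length ≤ 1 := fun μ' hμ' => hp μ' (by simp [hμ'])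
    rw [List.map_cons, List.sum_cons, ih hp']
    match μ, hμ with
    | [], _ =>
      have h1 : ∀ j : Fin n, List.count [j] (([] : List (Fin n)) :: p) = List.count [j] p := fun j =>
        List.count_cons_of_ne (by simp)
      simp only [List.map_nil, List.prod_nil, List.count_cons_self, h1, Nat.cast_add, Nat.cast_one]
      ring
    | [j₀], _ =>
      have h0 : List.count ([] : List (Fin n)) ([j₀] :: p) = List.count [] p :=
        List.count_cons_of_ne (by simp)
      have h1 : ∀ j : Fin n, (List.count [j] ([j₀] :: p) : ℕ) =
          List.count [j] p + if j = j₀ then 1 else 0 := by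
        intro j
        rw [List.count_cons]
        by_cases h : j = j₀
        · subst h; simp
        · have : ([j₀] == [j]) = false := by
            rw [beq_eq_false_iff_ne]; simpa [List.cons.injEq] using Ne.symm h
          simp [this, h]
      simp only [List.map_cons, List.map_nil, List.prod_cons, List.prod_nil, mul_one, h0, h1,
        Nat.cast_add, Nat.cast_ite, Nat.cast_one, Nat.cast_zero, add_mul, ite_mul, one_mul,
        zero_mul, Finset.sum_add_distrib, Finset.sum_ite_eq', Finset.mem_univ, if_true]
      ring
    | _ :: _ :: _, h => simp at h

/-- **A degree-`≤ 1` sparse map is affine**: `P.eval x` is the list of the values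
`cᵢ + (A x)ᵢ`, where `A = (#{[j] in Pᵢ} mod 2)ᵢⱼ` is the linear-part matrix and `cᵢ = #{[] in Pᵢ}
mod 2` the constant part. [DvirGutfreundRothblumVadhan2010, §1 p. 1]
[cite: DvirGutfreundRothblumVadhan2010, §1 p.1] -/
theorem eval_eq_ofFn_of_degLE_one {P : PolyMapF2 n} (h : P.DegLE 1) (x : Fin n → ZMod 2) :
    P.eval x = List.ofFn fun i : Fin P.length =>
      (((P.get i).count [] : ℕ) : ZMod 2) +
        (Matrix.of fun (i : Fin P.length) (j : Fin n) => (((P.get i).count [j] : ℕ) : ZMod 2)).mulVec x i := by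
  unfold PolyMapF2.eval
  rw [← List.ofFn_getElem_eq_map]
  congr 1
  funext i
  rw [sum_map_prod_eq_of_degLE_one _ (fun μ hμ => h _ (List.getElem_mem i.isLt) μ hμ) x]
  simp [Matrix.mulVec, dotProduct, Matrix.of_apply]

/-- **Entropy of a degree-`≤ 1` sparse map over `F₂` is the rank of its linear part** (in bits):
`H(P(U_n)) = rank_{F₂} (#{[j] in Pᵢ} mod 2)ᵢⱼ` — the image of the uniform distribution under an
affine map is flat on a coset of the image of the linear part (`mapEntropy_univ_affine_zmod_two`),
and listing the output coordinates (`List.ofFn`) is injective.  This is the polynomial-time base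
case `d = 1` of entropy approximation for polynomial maps. [DvirGutfreundRothblumVadhan2010, §1 p. 1]
[cite: DvirGutfreundRothblumVadhan2010, §1 p.1] -/
theorem entropy_eq_rank_of_degLE_one {P : PolyMapF2 n} (h : P.DegLE 1) :
    P.entropy =
      (Matrix.of fun (i : Fin P.length) (j : Fin n) => (((P.get i).count [j] : ℕ) : ZMod 2)).rank := by
  set A : Matrix (Fin P.length) (Fin n) (ZMod 2) :=
    Matrix.of fun (i : Fin P.length) (j : Fin n) => (((P.get i).count [j] : ℕ) : ZMod 2) with hA
  set c : Fin P.length → ZMod 2 := fun i => (((P.get i).count [] : ℕ) : ZMod 2) with hc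
  have hev : P.eval = (List.ofFn : (Fin P.length → ZMod 2) → List (ZMod 2)) ∘
      fun x => A.mulVecLin x + c := by
    funext x
    rw [eval_eq_ofFn_of_degLE_one h x]
    simp only [Function.comp_apply, Matrix.mulVecLin_apply]
    congr 1
    funext i
    simp only [Pi.add_apply, hc]
    exact add_comm _ _
  unfold PolyMapF2.entropy
  rw [hev,
    Literature.InformationTheory.Entropy.mapEntropy_comp_of_injOn _ _
      (fun a _ b _ hab => List.ofFn_injective hab),
    Literature.InformationTheory.Entropy.mapEntropy_univ_affine_zmod_two]
  rfl

end PolyMapF2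

end Literature.Computability.Complexity
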